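import Summits.CriticalPhenomena.PercolationContinuityZ3.Theorems.SahiMasterFamilyFCombOneSharedDict

/-!
# SCHEME Σ: the `e ∈ z` column classes (S4a), (S6a), (S6b) of `φ` (support file)

Support file (prover seat `prim-bnk-2`, gen 31–32; `--supports stmt-CriticalPhenomena-4575`).  Proof document
`run/shared/lean/prim/prim-l12/prim-bnk-2/PROOF-THEOREM-I1.md` §2 (✓adm) and §3 (injectivity).

Column sources with `e` in the third part `z`: (S4a) `T1⁻` with `x_I ∈ a \ A` ↦ `T1⁺` at `(G_b(x_I) ∪ x_J, y)` (`e` stays in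
`z`); (S6a) `T2⁻` with `x_J ∈ a′_w \ A_w` ↦ `T2⁺` at `(x_I ∪ M_w(x_J), y)`; (S6b) `T2⁻` with `x_J ∈ A_w` ↦ `T2⁺` at
`(x_I ∪ G′_w(x_J) + e, y)` (`e` moves to `x`).  For each class: domain, value of `φ`, the class of the new trace,
admissibility, signature (`4`, `8`, `9`) and injectivity on the class.  (Class (S4b), `x_I ∈ A`, with its displacement rule is
in `…OneSharedClassDisplace`.)  No definitions; no `sorry`.
-/

namespace Summit.CriticalPhenomena.PercolationContinuityZ3.Theorems

namespace SahiFComb.Shift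

open Finset FinsetFamily
open scoped Classical

variable {ι : Type*} [Fintype ι] [DecidableEq ι] [LinearOrder ι]

namespace OneShared

variable {S : OneShared ι}

/-! ### Class (S4a): `T1⁻`, `e ∈ z`, `x_I ∈ a \ A` -/

/-- (S4a) domain: `x_I ∈ (σQ \ P) \ A`. [this work] -/
theorem dom_S4a {x y : Finset ι} (hu : ((x, y), 0) ∈ ThreePartition.negUnitSetF S.B S.C) (hex : S.e ∉ x) (hey : S.e ∉ y)
    (hA : x ∩ S.I ∉ (S.dataI y).A) :
    x ∩ S.I ∈ ((secHigh (S.I \ (y ∩ S.I)) S.e S.B).image (fun t => (S.I \ (y ∩ S.I)) \ t) \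
      secLow (S.I \ (y ∩ S.I)) S.B) \ (S.dataI y).A := by
  rw [mem_negUnitSetF_iff] at hu
  obtain ⟨hxy, h⟩ := hu
  simp only at hxy h
  rcases h with ⟨-, ⟨-, hxB⟩, hzB⟩ | ⟨h1, -⟩ | ⟨h2, -⟩
  rotate_left
  · exact absurd h1 (by norm_num)
  · exact absurd h2 (by norm_num)
  have hxIR : x ∩ S.I ⊆ S.I \ (y ∩ S.I) := inter_subset_sdiff_inter hxy S.I
  have hzI : (x ∪ y)ᶜ ∩ S.I = (S.I \ (y ∩ S.I)) \ (x ∩ S.I) := compl_union_inter_eq x y S.I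
  have hez : S.e ∈ (x ∪ y)ᶜ := by rw [mem_compl, mem_union, not_or]; exact ⟨hex, hey⟩
  have hQR : ∀ s ∈ secHigh (S.I \ (y ∩ S.I)) S.e S.B, s ⊆ S.I \ (y ∩ S.I) := fun s hs => (mem_secHigh.1 hs).1
  rw [mem_sdiff, mem_sdiff, mem_image_ground_sdiff _ hQR]
  refine ⟨⟨⟨hxIR, ?_⟩, fun h => hxB ((mem_B_iff_secLow hex hxIR).2 h)⟩, hA⟩
  rw [← hzI]
  exact (mem_B_iff_secHigh hez (hzI ▸ sdiff_subset)).1 hzB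

/-- (S4a) the value of `φ`. [this work] -/
theorem phi_eq_S4a {x y : Finset ι} (hu : ((x, y), 0) ∈ ThreePartition.negUnitSetF S.B S.C) (hex : S.e ∉ x)
    (hey : S.e ∉ y) (hA : x ∩ S.I ∉ (S.dataI y).A) :
    S.phi ((x, y), 0) = (((x \ S.I) ∪ ((S.dataI y).Gb ⟨x ∩ S.I, dom_S4a hu hex hey hA⟩ : Finset ι), y), 0) := by
  unfold OneShared.phi
  simp only [hey, hex, if_false, if_true]
  rw [dif_neg hA, dif_pos (dom_S4a hu hex hey hA)]

/-- (S4a) the new `I`-trace `g = G_b(x_I)` lies in `b = P \ σQ`. [this work] -/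
theorem img_S4a {x y : Finset ι} (hu : ((x, y), 0) ∈ ThreePartition.negUnitSetF S.B S.C) (hex : S.e ∉ x) (hey : S.e ∉ y)
    (hA : x ∩ S.I ∉ (S.dataI y).A) :
    ((S.dataI y).Gb ⟨x ∩ S.I, dom_S4a hu hex hey hA⟩ : Finset ι) ⊆ S.I \ (y ∩ S.I) ∧
      ((S.dataI y).Gb ⟨x ∩ S.I, dom_S4a hu hex hey hA⟩ : Finset ι) ∈ S.B ∧
      (S.I \ (y ∩ S.I)) \ ((S.dataI y).Gb ⟨x ∩ S.I, dom_S4a hu hex hey hA⟩ : Finset ι) ∉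
        secHigh (S.I \ (y ∩ S.I)) S.e S.B := by
  have hQR : ∀ s ∈ secHigh (S.I \ (y ∩ S.I)) S.e S.B, s ⊆ S.I \ (y ∩ S.I) := fun s hs => (mem_secHigh.1 hs).1
  have hgmem := ((S.dataI y).Gb ⟨x ∩ S.I, dom_S4a hu hex hey hA⟩).2
  rw [mem_sdiff, mem_image_ground_sdiff _ hQR, mem_secLow] at hgmem
  obtain ⟨⟨hgR, hgB⟩, hgn⟩ := hgmem
  exact ⟨hgR, hgB, fun h => hgn ⟨hgR, h⟩⟩

/-- **Class (S4a)**: a `T1⁻` unit with `e ∈ z` and `x_I ∉ A` goes to the `T1⁺` unit (still `e ∈ z`) at `(G_b(x_I) ∪ x_J, y)`.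
[this work] -/
theorem phi_adm_S4a {x y : Finset ι} (hu : ((x, y), 0) ∈ ThreePartition.negUnitSetF S.B S.C) (hex : S.e ∉ x) (hey : S.e ∉ y)
    (hA : x ∩ S.I ∉ (S.dataI y).A) :
    S.phi ((x, y), 0) ∈ ThreePartition.posUnitSetF S.B S.C ∧ x ⊆ (S.phi ((x, y), 0)).1.1 ∧ y ⊆ (S.phi ((x, y), 0)).1.2 := by
  obtain ⟨hgR, hgB, hgn⟩ := img_S4a hu hex hey hA
  have hgdom : x ∩ S.I ⊆ ((S.dataI y).Gb ⟨x ∩ S.I, dom_S4a hu hex hey hA⟩ : Finset ι) :=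
    (S.dataI y).hGb ⟨x ∩ S.I, dom_S4a hu hex hey hA⟩
  rw [phi_eq_S4a hu hex hey hA]
  set g := ((S.dataI y).Gb ⟨x ∩ S.I, dom_S4a hu hex hey hA⟩ : Finset ι) with hg
  rw [mem_negUnitSetF_iff] at hu
  obtain ⟨hxy, h⟩ := hu
  simp only at hxy h
  rcases h with ⟨-, ⟨hxC, -⟩, -⟩ | ⟨h1, -⟩ | ⟨h2, -⟩
  rotate_left
  · exact absurd h1 (by norm_num)
  · exact absurd h2 (by norm_num)
  have hgI : g ⊆ S.I := hgR.trans sdiff_subset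
  have hex' : S.e ∉ (x \ S.I) ∪ g := fun h => hex ((nf_mem_iff S.heI hgI).1 h)
  have hdisj' : Disjoint ((x \ S.I) ∪ g) y := nf_disjoint hxy hgR
  have hez' : S.e ∈ (((x \ S.I) ∪ g) ∪ y)ᶜ := by rw [mem_compl, mem_union, not_or]; exact ⟨hex', hey⟩
  rw [mem_posUnitSetF_iff]
  refine ⟨⟨hdisj', Or.inl ⟨rfl, ⟨?_, ?_⟩, ?_⟩⟩, nf_subset hgdom, subset_rfl⟩
  · refine (mem_B_iff_secLow (R := S.I \ (y ∩ S.I)) hex' ?_).2 ?_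
    · rw [nf_inter hgI]; exact hgR
    · rw [nf_inter hgI]; exact mem_secLow.2 ⟨hgR, hgB⟩
  · have hxJ : x ∩ S.J ∈ secLow (S.J \ (y ∩ S.J)) S.C :=
      (mem_C_iff_secLow hex (inter_subset_sdiff_inter hxy S.J)).1 hxC
    refine (mem_C_iff_secLow hex' (inter_subset_sdiff_inter hdisj' S.J)).2 ?_
    rw [nf_inter_other S.hIJ hgI]; exact hxJ
  · intro hz'B
    have hz'I : (((x \ S.I) ∪ g) ∪ y)ᶜ ∩ S.I = (S.I \ (y ∩ S.I)) \ g := nf_compl_inter hgI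
    have h1 := (mem_B_iff_secHigh hez' (hz'I ▸ sdiff_subset)).1 hz'B
    rw [hz'I] at h1
    exact hgn h1

/-- (S4a) signature of the target: `4`. [this work] -/
theorem sig_phi_S4a {x y : Finset ι} (hu : ((x, y), 0) ∈ ThreePartition.negUnitSetF S.B S.C) (hex : S.e ∉ x) (hey : S.e ∉ y)
    (hA : x ∩ S.I ∉ (S.dataI y).A) : S.sig (S.phi ((x, y), 0)) = 4 := by
  have hgI := (img_S4a hu hex hey hA).1.trans sdiff_subset
  rw [phi_eq_S4a hu hex hey hA]
  exact S.sig_eq_4 rfl hey (fun h => hex ((nf_mem_iff S.heI hgI).1 h))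

/-- (S4a) `φ` is injective on the class. [this work] -/
theorem inj_S4a {x₁ y₁ x₂ y₂ : Finset ι} (hu₁ : ((x₁, y₁), 0) ∈ ThreePartition.negUnitSetF S.B S.C) (hex₁ : S.e ∉ x₁)
    (hey₁ : S.e ∉ y₁) (hA₁ : x₁ ∩ S.I ∉ (S.dataI y₁).A) (hu₂ : ((x₂, y₂), 0) ∈ ThreePartition.negUnitSetF S.B S.C)
    (hex₂ : S.e ∉ x₂) (hey₂ : S.e ∉ y₂) (hA₂ : x₂ ∩ S.I ∉ (S.dataI y₂).A)
    (h : S.phi ((x₁, y₁), 0) = S.phi ((x₂, y₂), 0)) : ((x₁, y₁), 0) = ((x₂, y₂), 0) := by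
  rw [phi_eq_S4a hu₁ hex₁ hey₁ hA₁, phi_eq_S4a hu₂ hex₂ hey₂ hA₂] at h
  simp only [Prod.mk.injEq, and_true] at h
  obtain ⟨hx, rfl⟩ := h
  have hg₁I := (img_S4a hu₁ hex₁ hey₁ hA₁).1.trans sdiff_subset
  have hg₂I := (img_S4a hu₂ hex₂ hey₂ hA₂).1.trans sdiff_subset
  have hI : x₁ ∩ S.I = x₂ ∩ S.I :=
    congrArg Subtype.val ((S.dataI _).Gb.injective (Subtype.ext (nf_eq_nf_inter hg₁I hg₂I hx)))
  have hJ : x₁ ∩ S.J = x₂ ∩ S.J := nf_eq_nf_inter_other S.hIJ hg₁I hg₂I hx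
  rw [part_eq_of_traces (s := x₁) (s' := x₂) ⟨fun h => absurd h hex₁, fun h => absurd h hex₂⟩ hI hJ]

/-! ### Class (S6a): `T2⁻`, `e ∈ z`, `x_J ∈ a′_w \ A_w` -/

/-- (S6a) domain: `x_J ∈ (σQ_w \ P_w) \ A_w`. [this work] -/
theorem dom_S6a {x y : Finset ι} (hu : ((x, y), 1) ∈ ThreePartition.negUnitSetF S.B S.C) (hex : S.e ∉ x) (hey : S.e ∉ y)
    (hA : x ∩ S.J ∉ (S.dataJ (y ∩ S.J)).A) :
    x ∩ S.J ∈ ((secHigh (S.J \ (y ∩ S.J)) S.e S.C).image (fun t => (S.J \ (y ∩ S.J)) \ t) \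
      secLow (S.J \ (y ∩ S.J)) S.C) \ (S.dataJ (y ∩ S.J)).A := by
  rw [mem_negUnitSetF_iff] at hu
  obtain ⟨hxy, h⟩ := hu
  simp only at hxy h
  rcases h with ⟨h0, -⟩ | ⟨-, ⟨-, hxC⟩, hzC⟩ | ⟨h2, -⟩
  · exact absurd h0 (by norm_num)
  rotate_left
  · exact absurd h2 (by norm_num)
  have hxJR : x ∩ S.J ⊆ S.J \ (y ∩ S.J) := inter_subset_sdiff_inter hxy S.J
  have hzJ : (x ∪ y)ᶜ ∩ S.J = (S.J \ (y ∩ S.J)) \ (x ∩ S.J) := compl_union_inter_eq x y S.J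
  have hez : S.e ∈ (x ∪ y)ᶜ := by rw [mem_compl, mem_union, not_or]; exact ⟨hex, hey⟩
  have hQR : ∀ s ∈ secHigh (S.J \ (y ∩ S.J)) S.e S.C, s ⊆ S.J \ (y ∩ S.J) := fun s hs => (mem_secHigh.1 hs).1
  rw [mem_sdiff, mem_sdiff, mem_image_ground_sdiff _ hQR]
  refine ⟨⟨⟨hxJR, ?_⟩, fun h => hxC ((mem_C_iff_secLow hex hxJR).2 h)⟩, hA⟩
  rw [← hzJ]
  exact (mem_C_iff_secHigh hez (hzJ ▸ sdiff_subset)).1 hzC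

/-- (S6a) the value of `φ`. [this work] -/
theorem phi_eq_S6a {x y : Finset ι} (hu : ((x, y), 1) ∈ ThreePartition.negUnitSetF S.B S.C) (hex : S.e ∉ x)
    (hey : S.e ∉ y) (hA : x ∩ S.J ∉ (S.dataJ (y ∩ S.J)).A) :
    S.phi ((x, y), 1) = (((x \ S.J) ∪ ((S.dataJ (y ∩ S.J)).Gb ⟨x ∩ S.J, dom_S6a hu hex hey hA⟩ : Finset ι), y), 1) := by
  unfold OneShared.phi
  simp only [hey, hex, if_false, if_true, Nat.one_ne_zero]
  rw [dif_neg hA, dif_pos (dom_S6a hu hex hey hA)]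

/-- (S6a) the new `J`-trace `g = M_w(x_J)` lies in `b′_w = P_w \ σQ_w`. [this work] -/
theorem img_S6a {x y : Finset ι} (hu : ((x, y), 1) ∈ ThreePartition.negUnitSetF S.B S.C) (hex : S.e ∉ x) (hey : S.e ∉ y)
    (hA : x ∩ S.J ∉ (S.dataJ (y ∩ S.J)).A) :
    ((S.dataJ (y ∩ S.J)).Gb ⟨x ∩ S.J, dom_S6a hu hex hey hA⟩ : Finset ι) ⊆ S.J \ (y ∩ S.J) ∧
      ((S.dataJ (y ∩ S.J)).Gb ⟨x ∩ S.J, dom_S6a hu hex hey hA⟩ : Finset ι) ∈ S.C ∧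
      (S.J \ (y ∩ S.J)) \ ((S.dataJ (y ∩ S.J)).Gb ⟨x ∩ S.J, dom_S6a hu hex hey hA⟩ : Finset ι) ∉
        secHigh (S.J \ (y ∩ S.J)) S.e S.C := by
  have hQR : ∀ s ∈ secHigh (S.J \ (y ∩ S.J)) S.e S.C, s ⊆ S.J \ (y ∩ S.J) := fun s hs => (mem_secHigh.1 hs).1
  have hgmem := ((S.dataJ (y ∩ S.J)).Gb ⟨x ∩ S.J, dom_S6a hu hex hey hA⟩).2
  rw [mem_sdiff, mem_image_ground_sdiff _ hQR, mem_secLow] at hgmem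
  obtain ⟨⟨hgR, hgC⟩, hgn⟩ := hgmem
  exact ⟨hgR, hgC, fun h => hgn ⟨hgR, h⟩⟩

/-- **Class (S6a)**: a `T2⁻` unit with `e ∈ z` and `x_J ∉ A_w` goes to the `T2⁺` unit at `(x_I ∪ M_w(x_J), y)`. [this work] -/
theorem phi_adm_S6a {x y : Finset ι} (hu : ((x, y), 1) ∈ ThreePartition.negUnitSetF S.B S.C) (hex : S.e ∉ x) (hey : S.e ∉ y)
    (hA : x ∩ S.J ∉ (S.dataJ (y ∩ S.J)).A) :
    S.phi ((x, y), 1) ∈ ThreePartition.posUnitSetF S.B S.C ∧ x ⊆ (S.phi ((x, y), 1)).1.1 ∧ y ⊆ (S.phi ((x, y), 1)).1.2 := by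
  obtain ⟨hgR, hgC, hgn⟩ := img_S6a hu hex hey hA
  have hgdom : x ∩ S.J ⊆ ((S.dataJ (y ∩ S.J)).Gb ⟨x ∩ S.J, dom_S6a hu hex hey hA⟩ : Finset ι) :=
    (S.dataJ (y ∩ S.J)).hGb ⟨x ∩ S.J, dom_S6a hu hex hey hA⟩
  rw [phi_eq_S6a hu hex hey hA]
  set g := ((S.dataJ (y ∩ S.J)).Gb ⟨x ∩ S.J, dom_S6a hu hex hey hA⟩ : Finset ι) with hg
  rw [mem_negUnitSetF_iff] at hu
  obtain ⟨hxy, h⟩ := hu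
  simp only at hxy h
  rcases h with ⟨h0, -⟩ | ⟨-, ⟨hxB, -⟩, -⟩ | ⟨h2, -⟩
  · exact absurd h0 (by norm_num)
  rotate_left
  · exact absurd h2 (by norm_num)
  have hgJ : g ⊆ S.J := hgR.trans sdiff_subset
  have hex' : S.e ∉ (x \ S.J) ∪ g := fun h => hex ((nf_mem_iff S.heJ hgJ).1 h)
  have hdisj' : Disjoint ((x \ S.J) ∪ g) y := nf_disjoint hxy hgR
  have hez' : S.e ∈ (((x \ S.J) ∪ g) ∪ y)ᶜ := by rw [mem_compl, mem_union, not_or]; exact ⟨hex', hey⟩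
  rw [mem_posUnitSetF_iff]
  refine ⟨⟨hdisj', Or.inr (Or.inl ⟨rfl, ⟨?_, ?_⟩, ?_⟩)⟩, nf_subset hgdom, subset_rfl⟩
  · have hxI : x ∩ S.I ∈ secLow (S.I \ (y ∩ S.I)) S.B :=
      (mem_B_iff_secLow hex (inter_subset_sdiff_inter hxy S.I)).1 hxB
    refine (mem_B_iff_secLow hex' (inter_subset_sdiff_inter hdisj' S.I)).2 ?_
    rw [nf_inter_other S.hIJ.symm hgJ]; exact hxI
  · refine (mem_C_iff_secLow (R := S.J \ (y ∩ S.J)) hex' ?_).2 ?_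
    · rw [nf_inter hgJ]; exact hgR
    · rw [nf_inter hgJ]; exact mem_secLow.2 ⟨hgR, hgC⟩
  · intro hz'C
    have hz'J : (((x \ S.J) ∪ g) ∪ y)ᶜ ∩ S.J = (S.J \ (y ∩ S.J)) \ g := nf_compl_inter hgJ
    have h1 := (mem_C_iff_secHigh hez' (hz'J ▸ sdiff_subset)).1 hz'C
    rw [hz'J] at h1
    exact hgn h1

/-- (S6a) signature of the target: `8`. [this work] -/
theorem sig_phi_S6a {x y : Finset ι} (hu : ((x, y), 1) ∈ ThreePartition.negUnitSetF S.B S.C) (hex : S.e ∉ x) (hey : S.e ∉ y)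
    (hA : x ∩ S.J ∉ (S.dataJ (y ∩ S.J)).A) : S.sig (S.phi ((x, y), 1)) = 8 := by
  have hgJ := (img_S6a hu hex hey hA).1.trans sdiff_subset
  rw [phi_eq_S6a hu hex hey hA]
  exact S.sig_eq_8 rfl hey (fun h => hex ((nf_mem_iff S.heJ hgJ).1 h))

/-- (S6a) `φ` is injective on the class. [this work] -/
theorem inj_S6a {x₁ y₁ x₂ y₂ : Finset ι} (hu₁ : ((x₁, y₁), 1) ∈ ThreePartition.negUnitSetF S.B S.C) (hex₁ : S.e ∉ x₁)
    (hey₁ : S.e ∉ y₁) (hA₁ : x₁ ∩ S.J ∉ (S.dataJ (y₁ ∩ S.J)).A) (hu₂ : ((x₂, y₂), 1) ∈ ThreePartition.negUnitSetF S.B S.C)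
    (hex₂ : S.e ∉ x₂) (hey₂ : S.e ∉ y₂) (hA₂ : x₂ ∩ S.J ∉ (S.dataJ (y₂ ∩ S.J)).A)
    (h : S.phi ((x₁, y₁), 1) = S.phi ((x₂, y₂), 1)) : ((x₁, y₁), 1) = ((x₂, y₂), 1) := by
  rw [phi_eq_S6a hu₁ hex₁ hey₁ hA₁, phi_eq_S6a hu₂ hex₂ hey₂ hA₂] at h
  simp only [Prod.mk.injEq, and_true] at h
  obtain ⟨hx, rfl⟩ := h
  have hg₁J := (img_S6a hu₁ hex₁ hey₁ hA₁).1.trans sdiff_subset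
  have hg₂J := (img_S6a hu₂ hex₂ hey₂ hA₂).1.trans sdiff_subset
  have hJ : x₁ ∩ S.J = x₂ ∩ S.J :=
    congrArg Subtype.val ((S.dataJ _).Gb.injective (Subtype.ext (nf_eq_nf_inter hg₁J hg₂J hx)))
  have hI : x₁ ∩ S.I = x₂ ∩ S.I := nf_eq_nf_inter_other S.hIJ.symm hg₁J hg₂J hx
  rw [part_eq_of_traces (s := x₁) (s' := x₂) ⟨fun h => absurd h hex₁, fun h => absurd h hex₂⟩ hI hJ]

/-! ### Class (S6b): `T2⁻`, `e ∈ z`, `x_J ∈ A_w` -/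

/-- (S6b) the value of `φ`. [this work] -/
theorem phi_eq_S6b {x y : Finset ι} (hex : S.e ∉ x) (hey : S.e ∉ y) (hA : x ∩ S.J ∈ (S.dataJ (y ∩ S.J)).A) :
    S.phi ((x, y), 1) = (((x \ S.J) ∪ ((S.dataJ (y ∩ S.J)).GT ⟨x ∩ S.J, hA⟩ : Finset ι) ∪ {S.e}, y), 1) := by
  unfold OneShared.phi
  simp only [hey, hex, if_false, if_true, Nat.one_ne_zero]
  rw [dif_pos hA]

/-- (S6b) the new `J`-trace `g = G′_w(x_J)` lies in `T_w = σA_w`: `g ⊆ J \ w`, `σ g ∈ A_w`, hence `g ∈ Q_w` and `σ g ∉ P_w`.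
[this work] -/
theorem img_S6b {x y : Finset ι} (hA : x ∩ S.J ∈ (S.dataJ (y ∩ S.J)).A) :
    ((S.dataJ (y ∩ S.J)).GT ⟨x ∩ S.J, hA⟩ : Finset ι) ⊆ S.J \ (y ∩ S.J) ∧
      ((S.dataJ (y ∩ S.J)).GT ⟨x ∩ S.J, hA⟩ : Finset ι) ∈ (S.dataJ (y ∩ S.J)).A.image (fun t => (S.J \ (y ∩ S.J)) \ t) ∧
      ((S.dataJ (y ∩ S.J)).GT ⟨x ∩ S.J, hA⟩ : Finset ι) ∈ secHigh (S.J \ (y ∩ S.J)) S.e S.C ∧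
      (S.J \ (y ∩ S.J)) \ ((S.dataJ (y ∩ S.J)).GT ⟨x ∩ S.J, hA⟩ : Finset ι) ∉ secLow (S.J \ (y ∩ S.J)) S.C := by
  set d := S.dataJ (y ∩ S.J) with hd
  have hQR : ∀ s ∈ secHigh (S.J \ (y ∩ S.J)) S.e S.C, s ⊆ S.J \ (y ∩ S.J) := fun s hs => (mem_secHigh.1 hs).1
  have hσQR : ∀ s ∈ (secHigh (S.J \ (y ∩ S.J)) S.e S.C).image (fun t => (S.J \ (y ∩ S.J)) \ t), s ⊆ S.J \ (y ∩ S.J) :=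
    fun s hs => ((mem_image_ground_sdiff _ hQR).1 hs).1
  have hAR : ∀ s ∈ d.A, s ⊆ S.J \ (y ∩ S.J) := fun s hs => hσQR s (mem_sdiff.1 (d.hAa hs)).1
  have hgmem : (d.GT ⟨x ∩ S.J, hA⟩ : Finset ι) ∈ d.A.image (fun t => (S.J \ (y ∩ S.J)) \ t) := (d.GT ⟨x ∩ S.J, hA⟩).2
  have hg := hgmem
  rw [mem_image_ground_sdiff _ hAR] at hg
  obtain ⟨hgR, hgA⟩ := hg
  have hσg := d.hAa hgA
  rw [mem_sdiff, mem_image_ground_sdiff _ hQR, sdiff_sdiff_right_self, inf_eq_inter, inter_eq_right.2 hgR] at hσg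
  obtain ⟨⟨-, hgQ⟩, hσgP⟩ := hσg
  exact ⟨hgR, hgmem, hgQ, hσgP⟩

/-- **Class (S6b)**: a `T2⁻` unit with `e ∈ z` and `x_J ∈ A_w` goes to the `T2⁺` unit at `(x_I ∪ G′_w(x_J) + e, y)`
(`e` moves from `z` to `x`). [this work] -/
theorem phi_adm_S6b {x y : Finset ι} (hu : ((x, y), 1) ∈ ThreePartition.negUnitSetF S.B S.C) (hex : S.e ∉ x) (hey : S.e ∉ y)
    (hA : x ∩ S.J ∈ (S.dataJ (y ∩ S.J)).A) :
    S.phi ((x, y), 1) ∈ ThreePartition.posUnitSetF S.B S.C ∧ x ⊆ (S.phi ((x, y), 1)).1.1 ∧ y ⊆ (S.phi ((x, y), 1)).1.2 := by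
  obtain ⟨hgR, -, hgQ, hσgP⟩ := img_S6b hA
  have hgdom : x ∩ S.J ⊆ ((S.dataJ (y ∩ S.J)).GT ⟨x ∩ S.J, hA⟩ : Finset ι) := (S.dataJ (y ∩ S.J)).hGT ⟨x ∩ S.J, hA⟩
  rw [phi_eq_S6b hex hey hA]
  set g := ((S.dataJ (y ∩ S.J)).GT ⟨x ∩ S.J, hA⟩ : Finset ι) with hg
  rw [mem_negUnitSetF_iff] at hu
  obtain ⟨hxy, h⟩ := hu
  simp only at hxy h
  rcases h with ⟨h0, -⟩ | ⟨-, ⟨hxB, -⟩, -⟩ | ⟨h2, -⟩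
  · exact absurd h0 (by norm_num)
  rotate_left
  · exact absurd h2 (by norm_num)
  have hgJ : g ⊆ S.J := hgR.trans sdiff_subset
  have hex' : S.e ∈ (x \ S.J) ∪ g ∪ {S.e} := nfe_mem
  have hdisj' : Disjoint ((x \ S.J) ∪ g ∪ {S.e}) y := nfe_disjoint hxy hgR hey
  rw [mem_posUnitSetF_iff]
  refine ⟨⟨hdisj', Or.inr (Or.inl ⟨rfl, ⟨?_, ?_⟩, ?_⟩)⟩, nfe_subset hgdom, subset_rfl⟩
  · -- `x' ∈ B`: `I`-trace unchanged, but now `e ∈ x'`: `B⁰ ⊆ B¹`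
    have hxI : x ∩ S.I ∈ secLow (S.I \ (y ∩ S.I)) S.B :=
      (mem_B_iff_secLow hex (inter_subset_sdiff_inter hxy S.I)).1 hxB
    refine (mem_B_iff_secHigh hex' (inter_subset_sdiff_inter hdisj' S.I)).2 ?_
    rw [nfe_inter_other S.hIJ.symm S.heI hgJ]
    exact secLow_subset_secHigh S.hBup (subset_univ _) (mem_univ _) hxI
  · -- `x' ∈ C`: `g ∈ Q`
    refine (mem_C_iff_secHigh (R := S.J \ (y ∩ S.J)) hex' ?_).2 ?_
    · rw [nfe_inter S.heJ hgJ]; exact hgR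
    · rw [nfe_inter S.heJ hgJ]; exact hgQ
  · -- `z' ∉ C`: `e ∉ z'`, `z' ∩ J = σ g ∉ P`
    intro hz'C
    have hz'J : (((x \ S.J) ∪ g ∪ {S.e}) ∪ y)ᶜ ∩ S.J = (S.J \ (y ∩ S.J)) \ g := nfe_compl_inter S.heJ hgJ
    have h1 := (mem_C_iff_secLow nfe_notMem_compl (hz'J ▸ sdiff_subset)).1 hz'C
    rw [hz'J] at h1
    exact hσgP h1

/-- (S6b) signature of the target: `9`. [this work] -/
theorem sig_phi_S6b {x y : Finset ι} (hu : ((x, y), 1) ∈ ThreePartition.negUnitSetF S.B S.C) (hex : S.e ∉ x) (hey : S.e ∉ y)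
    (hA : x ∩ S.J ∈ (S.dataJ (y ∩ S.J)).A) : S.sig (S.phi ((x, y), 1)) = 9 := by
  obtain ⟨hgR, hgT, -, -⟩ := img_S6b hA
  have hgJ := hgR.trans sdiff_subset
  have hu' := (mem_negUnitSetF_iff _ _ _).1 hu
  obtain ⟨hxy, h⟩ := hu'
  simp only at hxy h
  rcases h with ⟨h0, -⟩ | ⟨-, ⟨hxB, -⟩, -⟩ | ⟨h2, -⟩
  · exact absurd h0 (by norm_num)
  rotate_left
  · exact absurd h2 (by norm_num)
  have hxI : x ∩ S.I ∈ secLow (S.I \ (y ∩ S.I)) S.B :=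
    (mem_B_iff_secLow hex (inter_subset_sdiff_inter hxy S.I)).1 hxB
  rw [phi_eq_S6b hex hey hA]
  refine S.sig_eq_9 rfl hey nfe_mem ?_ ?_
  · show ((x \ S.J) ∪ _ ∪ {S.e}) ∩ S.J ∈ _
    rw [nfe_inter S.heJ hgJ]; exact hgT
  · show ((x \ S.J) ∪ _ ∪ {S.e}) ∩ S.I ∈ _
    rw [nfe_inter_other S.hIJ.symm S.heI hgJ]; exact hxI

/-- (S6b) `φ` is injective on the class. [this work] -/
theorem inj_S6b {x₁ y₁ x₂ y₂ : Finset ι} (hex₁ : S.e ∉ x₁) (hey₁ : S.e ∉ y₁) (hA₁ : x₁ ∩ S.J ∈ (S.dataJ (y₁ ∩ S.J)).A)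
    (hex₂ : S.e ∉ x₂) (hey₂ : S.e ∉ y₂) (hA₂ : x₂ ∩ S.J ∈ (S.dataJ (y₂ ∩ S.J)).A)
    (h : S.phi ((x₁, y₁), 1) = S.phi ((x₂, y₂), 1)) : ((x₁, y₁), 1) = ((x₂, y₂), 1) := by
  rw [phi_eq_S6b hex₁ hey₁ hA₁, phi_eq_S6b hex₂ hey₂ hA₂] at h
  simp only [Prod.mk.injEq, and_true] at h
  obtain ⟨hx, rfl⟩ := h
  have hg₁J := (img_S6b hA₁).1.trans sdiff_subset
  have hg₂J := (img_S6b hA₂).1.trans sdiff_subset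
  have hJ : x₁ ∩ S.J = x₂ ∩ S.J :=
    congrArg Subtype.val ((S.dataJ _).GT.injective (Subtype.ext (nfe_eq_nfe_inter S.heJ hg₁J hg₂J hx)))
  have hI : x₁ ∩ S.I = x₂ ∩ S.I := nfe_eq_nfe_inter_other S.hIJ.symm S.heI hg₁J hg₂J hx
  rw [part_eq_of_traces (s := x₁) (s' := x₂) ⟨fun h => absurd h hex₁, fun h => absurd h hex₂⟩ hI hJ]

end OneShared

end SahiFComb.Shift

end Summit.CriticalPhenomena.PercolationContinuityZ3.Theorems
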